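import Summits.QuantumFields.YangMills.Theorems.SwapVirialDeficitBlowUpGnomonicEulerJacobian
import HarnessLib

/-!
# The EULER-FIELD INTEGRATION BY PARTS on the gnomonic blow-up coordinates `GnoCoord L` (file A2 of the V2′ assembly of fcl-p3 g45's virial SPEC,
# memo2-24197-window v2 §2′): `∫ (Xg)·ρ = ∫ g·(W − (7+3|Fol L|))·ρ` for the MIXED Euler dilation ✓`eulerDilate`
# (free-hands support of ⟨stmt-QuantumFields-24197⟩ `SwapVirialDeficit.SwapGluedStiffness`)

This is the `GnoCoord L`-twin of w2 g57's ✓`Gnomonic.integral_flowDeriv_mul_piWeight` (followers, full dilation): here the dilation is the JOINT blow-up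
✓`eulerDilate eˢ` — transverse (`diag(1,eˢ,eˢ)`) on the leader letters `x, y`, full on `z` and on every follower — the density is ✓`gnoDensity` (G0 §4) and the
dilation defect is the Euler weight ✓`gnoW = w_⊥(η_x) + w_⊥(η_y) + W(η_z) + Σ_f W(η_f)`; the dilated dimension is `N = 7 + 3|Fol L| = 18L⁴ − 2 = 2α`.
* §1 ONE LETTER: `expWeight_eq_exp`, ★ `hasDerivAt_expWeight` — `d/ds [e^{−ds}((c + e^{−2s}B)⁻¹)²] = (4e^{−2s}B/(c + e^{−2s}B) − d)·[…]`, `expWeight_le` (`|s| ≤ 1`);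
* §2 THE RING: `eulerWeightPath_eq` (the dilated density `e^{−Ns}·ρ(eulerDilate e^{−s} η)` factorises into two transverse letters, one full letter and w2's
  ✓`Gnomonic.weightPath` of the followers), ★★ `hasDerivAt_eulerWeightPath` — its `s`-derivative is `(gnoW(eulerDilate e^{−s} η) − N)·(itself)`,
  `eulerWeightPath_le` — domination `≤ K_L·ρ(η)` on `|s| ≤ 1`;
* §3 ★★ `hasDerivAt_integral_eulerWeightPath`, ★★ `hasDerivAt_integral_eulerDilate` — `d/ds|₀ ∫ g(eulerDilate eˢ η)ρ(η) dη = ∫ g·(gnoW − N)·ρ` for bounded measurable `g`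
  (✓`integral_eulerDilate_gnoDensity` + dominated differentiation);
* §4 `hasDerivAt_eulerFlow`, ★★ `hasDerivAt_integral_eulerDilate_flow`, ★★★ `integral_eulerDeriv_mul_gnoDensity` — THE IDENTITY `∫ (Xg)·ρ = ∫ g·(gnoW − N)·ρ` for bounded
  measurable `g` whose flow derivative `Xg η = d/ds|₀ g(eulerDilate eˢ η)` exists everywhere and is bounded measurable.  With `g = e^{−bF̂}`, `F̂` the σ-glued
  deficit along the gnomonic blow-up (speed `≤ 324L⁴`, w2 g57's ✓`Gnomonic.hasDerivAt_chartDeficit_gnomonic_le`), this is the VIRIAL IDENTITY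
  `b·∫(XF̂)e^{−bF̂}ρ = ∫(N − gnoW)e^{−bF̂}ρ` of the memo (file B, next).
HONEST LABEL: real analysis at fixed `L`; nothing about ⟨24197⟩ (window-uniform) or any rung is proved; the Yang–Mills mass gap is NOT proved; no summit is proved by
a line.  Seat ym-line-fcl-p3 g46 (cell ym-idea-1, free hands; item of record ⟨24085⟩ aside, untouched), `--supports stmt-QuantumFields-24197`.  THEOREMS ONLY,
0 `sorry`, standard axioms.  References: [folklore] (Euler's identity ∕ virial by scaling).
-/

set_option autoImplicit false
set_option synthInstance.maxSize 1024

noncomputable section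

open MeasureTheory Set Filter Topology
open scoped BigOperators ENNReal

namespace Summit.QuantumFields.YangMills.Theorems.SwapVirialDeficit.BlowUpRing

open Summit.QuantumFields.YangMills.Theorems.SwapVirialDeficit.Gnomonic (normSq3 gnomonicWeight gnomonicW piWeight weightPath normSq3_nonneg
  normSq3_smul gnomonicWeight_pos piWeight_pos hasDerivAt_weightPath weightPath_le weightPath_zero gnomonicW_nonneg_le)

variable {L : ℕ} [NeZero L]

/-! ## §1 One letter: the dilated weight `e^{−ds}·((c + e^{−2s}B)⁻¹)²` -/

/-- The one-letter dilated weight as a single exponential (`c > 0`, `B ≥ 0`). [folklore] -/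
theorem expWeight_eq_exp {c B : ℝ} (hc : 0 < c) (hB : 0 ≤ B) (d s : ℝ) :
    Real.exp (-(d * s)) * ((c + Real.exp (-(2 * s)) * B)⁻¹) ^ 2 = Real.exp (-(d * s) - 2 * Real.log (c + Real.exp (-(2 * s)) * B)) := by
  have hq : 0 < c + Real.exp (-(2 * s)) * B := by positivity
  rw [sub_eq_add_neg, Real.exp_add,
    show -(2 * Real.log (c + Real.exp (-(2 * s)) * B)) = ((2 : ℕ) : ℝ) * Real.log ((c + Real.exp (-(2 * s)) * B)⁻¹) by
      rw [Real.log_inv]; push_cast; ring,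
    Real.exp_nat_mul, Real.exp_log (inv_pos.2 hq)]

/-- ★ **The derivative of the one-letter dilated weight**:
`d/ds [e^{−ds}((c + e^{−2s}B)⁻¹)²] = (4e^{−2s}B/(c + e^{−2s}B) − d) · e^{−ds}((c + e^{−2s}B)⁻¹)²`. [folklore] -/
theorem hasDerivAt_expWeight {c B : ℝ} (hc : 0 < c) (hB : 0 ≤ B) (d s : ℝ) :
    HasDerivAt (fun s : ℝ => Real.exp (-(d * s)) * ((c + Real.exp (-(2 * s)) * B)⁻¹) ^ 2)
      ((4 * (Real.exp (-(2 * s)) * B) / (c + Real.exp (-(2 * s)) * B) - d) * (Real.exp (-(d * s)) * ((c + Real.exp (-(2 * s)) * B)⁻¹) ^ 2)) s := by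
  have hq : ∀ s : ℝ, 0 < c + Real.exp (-(2 * s)) * B := fun s => by positivity
  have hE : HasDerivAt (fun s : ℝ => -(d * s) - 2 * Real.log (c + Real.exp (-(2 * s)) * B))
      (-d - 2 * ((Real.exp (-(2 * s)) * (-2) * B) / (c + Real.exp (-(2 * s)) * B))) s := by
    refine HasDerivAt.sub ?_ (HasDerivAt.const_mul 2 ?_)
    · have h := (hasDerivAt_id s).const_mul (-d)
      simpa [neg_mul] using h
    · have h1 : HasDerivAt (fun s : ℝ => Real.exp (-(2 * s))) (Real.exp (-(2 * s)) * (-2)) s := by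
        have h := ((hasDerivAt_id s).const_mul (2 : ℝ)).neg.exp
        simpa using h
      have h2 : HasDerivAt (fun s : ℝ => c + Real.exp (-(2 * s)) * B) (Real.exp (-(2 * s)) * (-2) * B) s := by
        have h := (h1.mul_const B).const_add c
        simpa using h
      exact h2.log (hq s).ne'
  have hexp := hE.exp
  have efun : (fun s : ℝ => Real.exp (-(d * s) - 2 * Real.log (c + Real.exp (-(2 * s)) * B))) =
      fun s => Real.exp (-(d * s)) * ((c + Real.exp (-(2 * s)) * B)⁻¹) ^ 2 := funext fun s => (expWeight_eq_exp hc hB d s).symm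
  rw [efun] at hexp
  convert hexp using 1
  rw [← expWeight_eq_exp hc hB d s, mul_comm]
  congr 1
  have hq' := (hq s).ne'
  field_simp
  ring

/-- The one-letter dilated weight on `|s| ≤ 1` (`d ≥ 0`): `e^{−ds}((c + e^{−2s}B)⁻¹)² ≤ e^{d}·e⁴·((c + B)⁻¹)²`. [folklore] -/
theorem expWeight_le {c B d s : ℝ} (hc : 0 < c) (hB : 0 ≤ B) (hd : 0 ≤ d) (hs : |s| ≤ 1) :
    Real.exp (-(d * s)) * ((c + Real.exp (-(2 * s)) * B)⁻¹) ^ 2 ≤ Real.exp d * Real.exp 4 * ((c + B)⁻¹) ^ 2 := by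
  have hs1 : s ≤ 1 := (le_abs_self s).trans hs
  have hs2 : -1 ≤ s := by have := neg_abs_le s; linarith
  have hq : 0 < c + Real.exp (-(2 * s)) * B := by positivity
  have he1 : (1 : ℝ) ≤ Real.exp 2 := Real.one_le_exp_iff.2 (by norm_num)
  have he2 : (1 : ℝ) ≤ Real.exp 2 * Real.exp (-(2 * s)) := by
    rw [← Real.exp_add]; exact Real.one_le_exp_iff.2 (by linarith)
  have key : (c + Real.exp (-(2 * s)) * B)⁻¹ ≤ Real.exp 2 * (c + B)⁻¹ := by
    rw [inv_le_comm₀ hq (by positivity), mul_inv, inv_inv, ← div_eq_inv_mul, div_le_iff₀ (by positivity)]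
    nlinarith
  have h0 : 0 ≤ (c + Real.exp (-(2 * s)) * B)⁻¹ := by positivity
  have hA : ((c + Real.exp (-(2 * s)) * B)⁻¹) ^ 2 ≤ Real.exp 4 * ((c + B)⁻¹) ^ 2 := by
    calc ((c + Real.exp (-(2 * s)) * B)⁻¹) ^ 2 ≤ (Real.exp 2 * (c + B)⁻¹) ^ 2 := pow_le_pow_left₀ h0 key 2
      _ = Real.exp 4 * ((c + B)⁻¹) ^ 2 := by rw [mul_pow, ← Real.exp_nat_mul]; norm_num
  have hB' : Real.exp (-(d * s)) ≤ Real.exp d := Real.exp_le_exp.2 (by nlinarith)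
  calc Real.exp (-(d * s)) * ((c + Real.exp (-(2 * s)) * B)⁻¹) ^ 2 ≤ Real.exp d * (Real.exp 4 * ((c + B)⁻¹) ^ 2) :=
        mul_le_mul hB' hA (by positivity) (Real.exp_pos _).le
    _ = Real.exp d * Real.exp 4 * ((c + B)⁻¹) ^ 2 := by ring

/-- `(e^{−s})² = e^{−2s}`. [folklore] -/
theorem exp_neg_sq (s : ℝ) : Real.exp (-s) ^ 2 = Real.exp (-(2 * s)) := by
  rw [← Real.exp_nat_mul]; congr 1; push_cast; ring

/-- `|v|² = v₀² + (v₁² + v₂²)`. [folklore] -/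
theorem normSq3_eq_three (v : Fin 3 → ℝ) : normSq3 v = v 0 ^ 2 + (v 1 ^ 2 + v 2 ^ 2) := by
  unfold normSq3; rw [Fin.sum_univ_three]; ring

/-! ## §2 The ring: the dilated gnomonic density `e^{−Ns}·ρ(eulerDilate e^{−s} η)`, `N = 7 + 3|Fol L|` -/

/-- The exponential prefactor splits letterwise: `e^{−Ns} = e^{−2s}·e^{−2s}·e^{−3s}·e^{−3|Fol L|s}`. [folklore] -/
theorem exp_neg_N_mul (s : ℝ) :
    Real.exp (-((7 + 3 * (Fintype.card (Fol L) : ℝ)) * s)) =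
      Real.exp (-(2 * s)) * Real.exp (-(2 * s)) * Real.exp (-(3 * s)) * Real.exp (-(3 * (Fintype.card (Fol L) : ℝ) * s)) := by
  rw [← Real.exp_add, ← Real.exp_add, ← Real.exp_add]; congr 1; ring

/-- ★ **The dilated gnomonic density factorises** into two transverse letters, one full letter and the followers' ✓`Gnomonic.weightPath`. [folklore] -/
theorem eulerWeightPath_eq (η : GnoCoord L) (s : ℝ) :
    Real.exp (-((7 + 3 * (Fintype.card (Fol L) : ℝ)) * s)) * gnoDensity (eulerDilate (Real.exp (-s)) η) =
      (Real.exp (-(2 * s)) * ((1 + η.1.1 0 ^ 2 + Real.exp (-(2 * s)) * (η.1.1 1 ^ 2 + η.1.1 2 ^ 2))⁻¹) ^ 2) *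
        (Real.exp (-(2 * s)) * ((1 + η.1.2 0 ^ 2 + Real.exp (-(2 * s)) * (η.1.2 1 ^ 2 + η.1.2 2 ^ 2))⁻¹) ^ 2) *
          (Real.exp (-(3 * s)) * ((1 + Real.exp (-(2 * s)) * normSq3 η.2.1)⁻¹) ^ 2) * weightPath η.2.2 s := by
  rw [exp_neg_N_mul, gnoDensity_eulerDilate, gnomonicWeight_trDil, gnomonicWeight_trDil, gnomonicWeight_smul, exp_neg_sq]
  unfold weightPath
  ring

/-- ★★ **THE `s`-DERIVATIVE OF THE DILATED GNOMONIC DENSITY IS `(gnoW − N)·(itself)`**: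
`d/ds [e^{−Ns}·ρ(eulerDilate e^{−s} η)] = (gnoW(eulerDilate e^{−s} η) − N) · e^{−Ns}·ρ(eulerDilate e^{−s} η)`, `N = 7 + 3|Fol L|`. [folklore] -/
theorem hasDerivAt_eulerWeightPath (η : GnoCoord L) (s : ℝ) :
    HasDerivAt (fun s : ℝ => Real.exp (-((7 + 3 * (Fintype.card (Fol L) : ℝ)) * s)) * gnoDensity (eulerDilate (Real.exp (-s)) η))
      ((gnoW (eulerDilate (Real.exp (-s)) η) - (7 + 3 * (Fintype.card (Fol L) : ℝ))) *
        (Real.exp (-((7 + 3 * (Fintype.card (Fol L) : ℝ)) * s)) * gnoDensity (eulerDilate (Real.exp (-s)) η))) s := by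
  have hcx : (0 : ℝ) < 1 + η.1.1 0 ^ 2 := by positivity
  have hcy : (0 : ℝ) < 1 + η.1.2 0 ^ 2 := by positivity
  have hBx : (0 : ℝ) ≤ η.1.1 1 ^ 2 + η.1.1 2 ^ 2 := by positivity
  have hBy : (0 : ℝ) ≤ η.1.2 1 ^ 2 + η.1.2 2 ^ 2 := by positivity
  have hx := hasDerivAt_expWeight hcx hBx 2 s
  have hy := hasDerivAt_expWeight hcy hBy 2 s
  have hz := hasDerivAt_expWeight one_pos (normSq3_nonneg η.2.1) 3 s
  have hF := hasDerivAt_weightPath η.2.2 s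
  have hder := ((hx.mul hy).mul hz).mul hF
  have hfun : (fun s : ℝ => Real.exp (-((7 + 3 * (Fintype.card (Fol L) : ℝ)) * s)) * gnoDensity (eulerDilate (Real.exp (-s)) η)) =
      fun s : ℝ => (Real.exp (-(2 * s)) * ((1 + η.1.1 0 ^ 2 + Real.exp (-(2 * s)) * (η.1.1 1 ^ 2 + η.1.1 2 ^ 2))⁻¹) ^ 2) *
        (Real.exp (-(2 * s)) * ((1 + η.1.2 0 ^ 2 + Real.exp (-(2 * s)) * (η.1.2 1 ^ 2 + η.1.2 2 ^ 2))⁻¹) ^ 2) *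
          (Real.exp (-(3 * s)) * ((1 + Real.exp (-(2 * s)) * normSq3 η.2.1)⁻¹) ^ 2) * weightPath η.2.2 s :=
    funext fun s => eulerWeightPath_eq η s
  rw [hfun]
  refine hder.congr_deriv ?_
  simp only [Pi.mul_apply]
  rw [eulerWeightPath_eq η s, gnoW_eulerDilate, gnoWtr_trDil, gnoWtr_trDil, gnomonicW_smul, exp_neg_sq]
  ring

/-- The dilated gnomonic density is positive. [folklore] -/
theorem eulerWeightPath_pos (η : GnoCoord L) (s : ℝ) :
    0 < Real.exp (-((7 + 3 * (Fintype.card (Fol L) : ℝ)) * s)) * gnoDensity (eulerDilate (Real.exp (-s)) η) :=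
  mul_pos (Real.exp_pos _) (gnoDensity_pos _)

/-- **Domination on `|s| ≤ 1`**: `e^{−Ns}·ρ(eulerDilate e^{−s} η) ≤ K_L · ρ(η)` with `K_L = e⁶·e⁶·e⁷·e^{3|Fol L|}·e^{4|Fol L|}`. [folklore] -/
theorem eulerWeightPath_le {s : ℝ} (hs : |s| ≤ 1) (η : GnoCoord L) :
    Real.exp (-((7 + 3 * (Fintype.card (Fol L) : ℝ)) * s)) * gnoDensity (eulerDilate (Real.exp (-s)) η) ≤
      (Real.exp 2 * Real.exp 4 * (Real.exp 2 * Real.exp 4) * (Real.exp 3 * Real.exp 4) *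
        (Real.exp (3 * (Fintype.card (Fol L) : ℝ)) * Real.exp 4 ^ Fintype.card (Fol L))) * gnoDensity η := by
  have hcx : (0 : ℝ) < 1 + η.1.1 0 ^ 2 := by positivity
  have hcy : (0 : ℝ) < 1 + η.1.2 0 ^ 2 := by positivity
  have hBx : (0 : ℝ) ≤ η.1.1 1 ^ 2 + η.1.1 2 ^ 2 := by positivity
  have hBy : (0 : ℝ) ≤ η.1.2 1 ^ 2 + η.1.2 2 ^ 2 := by positivity
  have hx := expWeight_le hcx hBx (by norm_num : (0 : ℝ) ≤ 2) hs
  have hy := expWeight_le hcy hBy (by norm_num : (0 : ℝ) ≤ 2) hs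
  have hz := expWeight_le one_pos (normSq3_nonneg η.2.1) (by norm_num : (0 : ℝ) ≤ 3) hs
  have hF := (le_abs_self _).trans (weightPath_le hs η.2.2)
  have ex : ((1 + η.1.1 0 ^ 2 + (η.1.1 1 ^ 2 + η.1.1 2 ^ 2))⁻¹) ^ 2 = gnomonicWeight η.1.1 := by
    unfold gnomonicWeight; rw [normSq3_eq_three, add_assoc]
  have ey : ((1 + η.1.2 0 ^ 2 + (η.1.2 1 ^ 2 + η.1.2 2 ^ 2))⁻¹) ^ 2 = gnomonicWeight η.1.2 := by
    unfold gnomonicWeight; rw [normSq3_eq_three, add_assoc]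
  have ez : ((1 + normSq3 η.2.1)⁻¹) ^ 2 = gnomonicWeight η.2.1 := rfl
  rw [ex] at hx; rw [ey] at hy; rw [ez] at hz
  rw [eulerWeightPath_eq]
  have p1 : 0 ≤ Real.exp (-(2 * s)) * ((1 + η.1.1 0 ^ 2 + Real.exp (-(2 * s)) * (η.1.1 1 ^ 2 + η.1.1 2 ^ 2))⁻¹) ^ 2 := by positivity
  have p2 : 0 ≤ Real.exp (-(2 * s)) * ((1 + η.1.2 0 ^ 2 + Real.exp (-(2 * s)) * (η.1.2 1 ^ 2 + η.1.2 2 ^ 2))⁻¹) ^ 2 := by positivity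
  have p3 : 0 ≤ Real.exp (-(3 * s)) * ((1 + Real.exp (-(2 * s)) * normSq3 η.2.1)⁻¹) ^ 2 := by
    have := normSq3_nonneg η.2.1; positivity
  have p4 : 0 ≤ weightPath η.2.2 s := by
    unfold weightPath; exact mul_nonneg (Real.exp_pos _).le (piWeight_pos _).le
  have q1 : 0 ≤ Real.exp 2 * Real.exp 4 * gnomonicWeight η.1.1 := by have := gnomonicWeight_pos η.1.1; positivity
  have q12 : 0 ≤ Real.exp 2 * Real.exp 4 * gnomonicWeight η.1.1 * (Real.exp 2 * Real.exp 4 * gnomonicWeight η.1.2) :=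
    mul_nonneg q1 (by have := gnomonicWeight_pos η.1.2; positivity)
  have q123 : 0 ≤ Real.exp 2 * Real.exp 4 * gnomonicWeight η.1.1 * (Real.exp 2 * Real.exp 4 * gnomonicWeight η.1.2) *
      (Real.exp 3 * Real.exp 4 * gnomonicWeight η.2.1) := mul_nonneg q12 (by have := gnomonicWeight_pos η.2.1; positivity)
  calc _ ≤ (Real.exp 2 * Real.exp 4 * gnomonicWeight η.1.1) * (Real.exp 2 * Real.exp 4 * gnomonicWeight η.1.2) *
        (Real.exp 3 * Real.exp 4 * gnomonicWeight η.2.1) *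
          (Real.exp (3 * (Fintype.card (Fol L) : ℝ)) * (Real.exp 4 ^ Fintype.card (Fol L) * piWeight η.2.2)) :=
        mul_le_mul (mul_le_mul (mul_le_mul hx hy p2 q1) hz p3 q12) hF p4 q123
    _ = _ := by unfold gnoDensity; ring

/-- The dilated gnomonic density is measurable in `η`. [folklore] -/
theorem measurable_eulerWeightPath (s : ℝ) :
    Measurable fun η : GnoCoord L => Real.exp (-((7 + 3 * (Fintype.card (Fol L) : ℝ)) * s)) * gnoDensity (eulerDilate (Real.exp (-s)) η) :=
  measurable_const.mul (measurable_gnoDensity.comp (measurable_eulerDilate _))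

/-! ## §3 Differentiating the dilated density under the integral -/

/-- ★★ **Differentiating the dilated gnomonic density under the integral**: for bounded measurable `g`,
`d/ds|₀ ∫ g(η)·e^{−Ns}·ρ(eulerDilate e^{−s} η) dη = ∫ g(η)·(gnoW(η) − N)·ρ(η) dη` (dominated differentiation on `|s| < 1`). [folklore] -/
theorem hasDerivAt_integral_eulerWeightPath {g : GnoCoord L → ℝ} (hg : Measurable g) {M : ℝ} (hbd : ∀ η, |g η| ≤ M) :
    HasDerivAt (fun s : ℝ => ∫ η : GnoCoord L, g η * (Real.exp (-((7 + 3 * (Fintype.card (Fol L) : ℝ)) * s)) * gnoDensity (eulerDilate (Real.exp (-s)) η)))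
      (∫ η : GnoCoord L, g η * ((gnoW η - (7 + 3 * (Fintype.card (Fol L) : ℝ))) * gnoDensity η)) 0 := by
  have hM : 0 ≤ M := (abs_nonneg _).trans (hbd ((0, 0), 0, fun _ => 0))
  set N : ℝ := 7 + 3 * (Fintype.card (Fol L) : ℝ) with hN
  set K : ℝ := Real.exp 2 * Real.exp 4 * (Real.exp 2 * Real.exp 4) * (Real.exp 3 * Real.exp 4) *
    (Real.exp (3 * (Fintype.card (Fol L) : ℝ)) * Real.exp 4 ^ Fintype.card (Fol L)) with hK
  have hN0 : 0 ≤ N := by rw [hN]; positivity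
  have hWm : ∀ s : ℝ, Measurable fun η : GnoCoord L => gnoW (eulerDilate (Real.exp (-s)) η) - N := fun s =>
    (measurable_gnoW.comp (measurable_eulerDilate _)).sub measurable_const
  have key := hasDerivAt_integral_of_dominated_loc_of_deriv_le (μ := (volume : Measure (GnoCoord L))) (x₀ := (0 : ℝ))
    (s := Metric.ball (0 : ℝ) 1) (F := fun s η => g η * (Real.exp (-(N * s)) * gnoDensity (eulerDilate (Real.exp (-s)) η)))
    (F' := fun s η => g η * ((gnoW (eulerDilate (Real.exp (-s)) η) - N) * (Real.exp (-(N * s)) * gnoDensity (eulerDilate (Real.exp (-s)) η))))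
    (bound := fun η => M * ((N + 4 * (3 + (Fintype.card (Fol L) : ℝ))) * (K * gnoDensity η)))
    (Metric.ball_mem_nhds 0 one_pos) ?_ ?_ ?_ ?_ ?_ ?_
  · have e : (fun η : GnoCoord L => g η * ((gnoW (eulerDilate (Real.exp (-(0 : ℝ))) η) - N) *
        (Real.exp (-(N * 0)) * gnoDensity (eulerDilate (Real.exp (-(0 : ℝ))) η)))) = fun η => g η * ((gnoW η - N) * gnoDensity η) := by
      funext η; simp only [neg_zero, Real.exp_zero, mul_zero, eulerDilate_one, one_mul]
    rw [e] at key
    exact key.2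
  · exact Eventually.of_forall fun s => (hg.mul (measurable_eulerWeightPath s)).aestronglyMeasurable
  · -- integrability at `s = 0`
    refine Integrable.mono' (integrable_gnoDensity.const_mul M) (hg.mul (measurable_eulerWeightPath 0)).aestronglyMeasurable (ae_of_all _ fun η => ?_)
    simp only [neg_zero, Real.exp_zero, mul_zero, eulerDilate_one, one_mul]
    rw [Real.norm_eq_abs, abs_mul, abs_of_pos (gnoDensity_pos η)]
    exact mul_le_mul_of_nonneg_right (hbd η) (gnoDensity_pos η).le
  · exact (hg.mul ((hWm 0).mul (measurable_eulerWeightPath 0))).aestronglyMeasurable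
  · refine ae_of_all _ fun η s hs => ?_
    have hs' : |s| ≤ 1 := by rw [Metric.mem_ball, dist_zero_right, Real.norm_eq_abs] at hs; exact hs.le
    rw [Real.norm_eq_abs, abs_mul, abs_mul, abs_of_pos (eulerWeightPath_pos η s)]
    have hW : |gnoW (eulerDilate (Real.exp (-s)) η) - N| ≤ N + 4 * (3 + (Fintype.card (Fol L) : ℝ)) := abs_gnoW_sub_le _
    have h7 : 0 ≤ N + 4 * (3 + (Fintype.card (Fol L) : ℝ)) := add_nonneg hN0 (by positivity)
    exact mul_le_mul (hbd η) (mul_le_mul hW (eulerWeightPath_le hs' η) (eulerWeightPath_pos η s).le h7)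
      (mul_nonneg (abs_nonneg _) (eulerWeightPath_pos η s).le) hM
  · exact ((integrable_gnoDensity.const_mul K).const_mul _).const_mul M
  · exact ae_of_all _ fun η s _ => (hasDerivAt_eulerWeightPath η s).const_mul (g η)

/-- ★★ **THE EULER-DILATION INTEGRAL IS DIFFERENTIABLE, WITH DERIVATIVE `∫ g·(gnoW − N)·ρ`**: for bounded measurable `g`,
`d/ds|₀ ∫ g(eulerDilate eˢ η)·ρ(η) dη = ∫ g(η)·(gnoW(η) − N)·ρ(η) dη` (change of variables ✓`integral_eulerDilate_gnoDensity`, then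
`hasDerivAt_integral_eulerWeightPath`). [folklore] -/
theorem hasDerivAt_integral_eulerDilate {g : GnoCoord L → ℝ} (hg : Measurable g) {M : ℝ} (hbd : ∀ η, |g η| ≤ M) :
    HasDerivAt (fun s : ℝ => ∫ η : GnoCoord L, g (eulerDilate (Real.exp s) η) * gnoDensity η)
      (∫ η : GnoCoord L, g η * ((gnoW η - (7 + 3 * (Fintype.card (Fol L) : ℝ))) * gnoDensity η)) 0 := by
  have e : (fun s : ℝ => ∫ η : GnoCoord L, g (eulerDilate (Real.exp s) η) * gnoDensity η) =
      fun s => ∫ η : GnoCoord L, g η * (Real.exp (-((7 + 3 * (Fintype.card (Fol L) : ℝ)) * s)) * gnoDensity (eulerDilate (Real.exp (-s)) η)) := by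
    funext s
    rw [integral_eulerDilate_gnoDensity, ← integral_const_mul]
    refine integral_congr_ae (ae_of_all _ fun η => ?_)
    ring
  rw [e]
  exact hasDerivAt_integral_eulerWeightPath hg hbd

/-! ## §4 The flow derivative and the Euler-field identity -/

omit [NeZero L] in
/-- The flow property of the Euler dilation: a derivative at `s = 0` along `s ↦ g(eulerDilate eˢ η)` for every `η` gives the derivative at every `s`. [folklore] -/
theorem hasDerivAt_eulerFlow {g Xg : GnoCoord L → ℝ} (hX : ∀ η, HasDerivAt (fun s : ℝ => g (eulerDilate (Real.exp s) η)) (Xg η) 0)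
    (η : GnoCoord L) (s : ℝ) :
    HasDerivAt (fun s' : ℝ => g (eulerDilate (Real.exp s') η)) (Xg (eulerDilate (Real.exp s) η)) s := by
  have h := hX (eulerDilate (Real.exp s) η)
  have e : (fun s' : ℝ => g (eulerDilate (Real.exp s') η)) = (fun u : ℝ => g (eulerDilate (Real.exp u) (eulerDilate (Real.exp s) η))) ∘ fun s' => s' - s := by
    funext s'
    simp only [Function.comp_apply, eulerDilate_eulerDilate, ← Real.exp_add, sub_add_cancel]
  rw [e]
  have hsub : HasDerivAt (fun s' : ℝ => s' - s) 1 s := by simpa using (hasDerivAt_id s).sub_const s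
  have h0 : HasDerivAt (fun u : ℝ => g (eulerDilate (Real.exp u) (eulerDilate (Real.exp s) η))) (Xg (eulerDilate (Real.exp s) η))
      ((fun s' : ℝ => s' - s) s) := by
    simp only [sub_self]; exact h
  have hc := HasDerivAt.scomp (h := fun s' : ℝ => s' - s) s h0 hsub
  simpa using hc

/-- ★★ **Differentiating along the Euler flow under the integral**: if `g` is bounded measurable and `s ↦ g(eulerDilate eˢ η)` has derivative `Xg η` at `0` for
every `η`, with `Xg` bounded measurable, then `d/ds|₀ ∫ g(eulerDilate eˢ η)·ρ(η) dη = ∫ (Xg)·ρ`. [folklore] -/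
theorem hasDerivAt_integral_eulerDilate_flow {g Xg : GnoCoord L → ℝ} (hg : Measurable g) {M : ℝ} (hbd : ∀ η, |g η| ≤ M)
    (hX : ∀ η, HasDerivAt (fun s : ℝ => g (eulerDilate (Real.exp s) η)) (Xg η) 0) (hXm : Measurable Xg) {M' : ℝ} (hXbd : ∀ η, |Xg η| ≤ M') :
    HasDerivAt (fun s : ℝ => ∫ η : GnoCoord L, g (eulerDilate (Real.exp s) η) * gnoDensity η) (∫ η : GnoCoord L, Xg η * gnoDensity η) 0 := by
  have key := hasDerivAt_integral_of_dominated_loc_of_deriv_le (μ := (volume : Measure (GnoCoord L))) (x₀ := (0 : ℝ))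
    (s := Metric.ball (0 : ℝ) 1) (F := fun s η => g (eulerDilate (Real.exp s) η) * gnoDensity η)
    (F' := fun s η => Xg (eulerDilate (Real.exp s) η) * gnoDensity η)
    (bound := fun η => M' * gnoDensity η) (Metric.ball_mem_nhds 0 one_pos) ?_ ?_ ?_ ?_ ?_ ?_
  · simpa only [Real.exp_zero, eulerDilate_one] using key.2
  · exact Eventually.of_forall fun s => ((hg.comp (measurable_eulerDilate _)).mul measurable_gnoDensity).aestronglyMeasurable
  · refine Integrable.mono' (integrable_gnoDensity.const_mul M) ((hg.comp (measurable_eulerDilate _)).mul measurable_gnoDensity).aestronglyMeasurable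
      (ae_of_all _ fun η => ?_)
    rw [Real.norm_eq_abs, abs_mul, abs_of_pos (gnoDensity_pos η)]
    exact mul_le_mul_of_nonneg_right (hbd _) (gnoDensity_pos η).le
  · exact ((hXm.comp (measurable_eulerDilate _)).mul measurable_gnoDensity).aestronglyMeasurable
  · refine ae_of_all _ fun η s _ => ?_
    rw [Real.norm_eq_abs, abs_mul, abs_of_pos (gnoDensity_pos η)]
    exact mul_le_mul_of_nonneg_right (hXbd _) (gnoDensity_pos η).le
  · exact integrable_gnoDensity.const_mul _
  · exact ae_of_all _ fun η s _ => (hasDerivAt_eulerFlow hX η s).mul_const _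

/-- ★★★ **THE EULER-FIELD IDENTITY ON THE GNOMONIC BLOW-UP COORDINATES** (integration by parts for the mixed Euler field, NO boundary term): for a bounded
measurable `g` whose flow derivative `Xg η = d/ds|₀ g(eulerDilate eˢ η)` exists everywhere and is bounded measurable,
`∫ (Xg)·ρ = ∫ g·(gnoW − N)·ρ`, `ρ = gnoDensity`, `N = 7 + 3|Fol L| = 18L⁴ − 2`.  With `g = e^{−bF̂}` this is the virial identity
`b·∫(XF̂)e^{−bF̂}ρ = ∫(N − gnoW)e^{−bF̂}ρ` of memo2-24197-window §2′. [folklore] -/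
theorem integral_eulerDeriv_mul_gnoDensity {g Xg : GnoCoord L → ℝ} (hg : Measurable g) {M : ℝ} (hbd : ∀ η, |g η| ≤ M)
    (hX : ∀ η, HasDerivAt (fun s : ℝ => g (eulerDilate (Real.exp s) η)) (Xg η) 0) (hXm : Measurable Xg) {M' : ℝ} (hXbd : ∀ η, |Xg η| ≤ M') :
    ∫ η : GnoCoord L, Xg η * gnoDensity η =
      ∫ η : GnoCoord L, g η * ((gnoW η - (7 + 3 * (Fintype.card (Fol L) : ℝ))) * gnoDensity η) :=
  (hasDerivAt_integral_eulerDilate_flow hg hbd hX hXm hXbd).unique (hasDerivAt_integral_eulerDilate hg hbd)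

end Summit.QuantumFields.YangMills.Theorems.SwapVirialDeficit.BlowUpRing

end
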